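import Summits.QuantumFields.YangMills.Theorems.BalabanUVNodesN15OperatorLayerOfRecordY
import Literature.MathematicalPhysics.QuantumFieldTheory.Balaban1983to89.Node00.OpsYSiteKernelPair
import HarnessLib

/-!
# Route «BalabanUVNodes», node N15 = NE2 AT THE RECORD, part R-K′: THE RECORD LITERAL WITH def-Y's TWO-MEMBER SITE ∕ UNIT READERS BY NAME

WHO ∕ WHEN.  Cell `pub-ymgap`, seat `pub-ymgap-dag-n15-a` (g22); `--supports stmt-QuantumFields-27366 --as helper` (count-neutral).  Sequel of R-K (`…OperatorLayerOfRecordY`,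
p627101: `ne2ObjectsOfRecordY` with the site ∕ unit kernels, the region and the unit distance as PARAMETERS) after def-Y g22's FILE 44 (`Node00/OpsYSiteKernelPair`, p628585:
the two-member site-kernel difference reader `siteKernelS₂Y`) — the BY-NAME swap def-Y announced (bus 2026-08-28T11:26:55Z): `Ksite := fun i ↦ siteKernelS₂Y G (x i) (n i) (avg i) (Sf i) (Sc i)`,
`Kunit := fun i ↦ siteKernelS₂Y G (x i) (n i) (avg i) (Uf i) (Uc i)`, `inΛ := fun i ↦ inΛY (x i)`, `unitDist := fun i ↦ unitDistY (x i)`.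
WHAT.  ★ `ne2ObjectsOfRecordYK` (one `def`, an instantiation of R-K's literal — no new object): the NE2 objects of record whose ONLY remaining parameters are the index family, the
averaging maps `avg i` (King's n-fold average is not constructed in the tree), the operator-layer site letters `Of ∕ Oc` and the block letters `Sf ∕ Sc` ((3.48), record: the two
members' `CovLettersY.C`) and `Uf ∕ Uc` ((3.187), record: `.Ck` — a genuine READER of the record's residual `C̃^{(k)}` letter, as def-Y says); `ne2ObjectsOfRecordYK_eq` (rfl),
`ksite_∕kunit_∕inΛ_∕unitDist_ne2ObjectsOfRecordYK` (rfl), ★★ `n15At_ne2ObjectsOfRecordYK_iff` (`Iff.rfl`: the node's conjunction at this literal = `NE2PlusOperator` over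
`kernelFamilyS₂Y` ∧ `NE2PlusSite 4 p` over `siteKernelS₂Y … Sf Sc` ∧ `NE2PlusUnit` over `siteKernelS₂Y … Uf Uc`, `inΛY`, `unitDistY`), `n15At_ne2ObjectsOfRecordYK_of` (the socket).
The γ = 0 ∕ θ = 1 FLOORS of the site ∕ unit clauses are def-Y's `etaRateIneqSite_zero_siteKernelS₂Y_of_bounds` ∕ `etaRateIneqUnit_one_siteKernelS₂Y_of_bounds` (FILE 44 §3) at these
kernels BY NAME; the η-GAIN (γ > 0, θ < 1) is N15's content and is NOT asserted here.
HONEST FRAMING ∕ LIMITS.  Objects + `rfl` bookkeeping; NO estimate; NE2⁺ NOT PRINTED ([B9] proves (3.42)∕(3.48)∕(3.187) at ONE spacing; King Prop. 3.9 is the abelian template);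
N15 NOT discharged; counts UNMOVED (typed 28∕28 · discharged 5∕27 · A 5∕28); NOT continuum ∕ ℝ⁴ ∕ OS ∕ mass gap ∕ Clay.
-/

set_option autoImplicit false

noncomputable section

namespace Summit.QuantumFields.YangMills.BalabanUVNodes.N15.GenuineRecord

open Literature.MathematicalPhysics.QuantumFieldTheory.Balaban1983to89
open Literature.MathematicalPhysics.QuantumFieldTheory.Balaban1983to89.T4EtaRate (PairedInstance NE2PlusOperator NE2PlusSite NE2PlusUnit EtaRateIneq342)
open Literature.MathematicalPhysics.QuantumFieldTheory.Balaban1983to89.B9PinMembersKLevelV1 (MemberY geo9Y bg9Y)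
open Literature.MathematicalPhysics.QuantumFieldTheory.Balaban1983to89.B9PinGeometryKLevelV1 (inΛY unitDistY)
open Literature.MathematicalPhysics.QuantumFieldTheory.Balaban1983to89.Node00 (NE2Objects₁₁ CfgY SiteOpY)
open Literature.MathematicalPhysics.QuantumFieldTheory.Balaban1983to89.Node00.MemberYRefine (refineY)
open Literature.MathematicalPhysics.QuantumFieldTheory.Balaban1983to89.Node00.OpsYRead342Pair (pairingY pairedInstanceY kernelFamilyS₂Y)
open Literature.MathematicalPhysics.QuantumFieldTheory.Balaban1983to89.Node00.OpsYSiteKernelPair (BlkLetterY siteKernelS₂Y)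
open YMDAG.UVSplit (NE2Carriers N15At ne2OfRecord₁₁)

variable {d ℓ : ℕ} {hd : 1 ≤ d + 1} {hL : Odd (ℓ + 1) ∧ 1 < ℓ + 1} {b₀ b₁ : ℝ} {Mstar : ℕ}
variable {𝔸 : Type} [NormedRing 𝔸] [NormedAlgebra ℂ 𝔸] [CompleteSpace 𝔸]

section Kernels

variable (G : Subgroup 𝔸ˣ) {I : Type} (x : I → MemberY d ℓ hd hL b₀ b₁ Mstar) (n : I → ℕ)
  (avg : ∀ i, CfgY 𝔸 (refineY (x i) (n i)).toKIdx → CfgY 𝔸 (x i).toKIdx)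
  (havg : ∀ i, avg i (bg9Y 𝔸 G (refineY (x i) (n i))).one = (bg9Y 𝔸 G (x i)).one)
  (Of : ∀ i, SiteOpY 𝔸 (refineY (x i) (n i)).toKIdx) (Oc : ∀ i, SiteOpY 𝔸 (x i).toKIdx)
  (Sf : ∀ i, BlkLetterY 𝔸 (refineY (x i) (n i)).toKIdx) (Sc : ∀ i, BlkLetterY 𝔸 (x i).toKIdx)
  (Uf : ∀ i, BlkLetterY 𝔸 (refineY (x i) (n i)).toKIdx) (Uc : ∀ i, BlkLetterY 𝔸 (x i).toKIdx) (c35 p : ℝ)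

/-- ★ **N15's NE2 OBJECTS AT THE RECORD WITH THE SITE ∕ UNIT READERS BY NAME**: R-K's `ne2ObjectsOfRecordY` at `Ksite i := siteKernelS₂Y G (x i) (n i) (avg i) (Sf i) (Sc i)`
(the two-member (3.48) difference reader at the block letters `Sf ∕ Sc`), `Kunit i := siteKernelS₂Y G (x i) (n i) (avg i) (Uf i) (Uc i)` (the same reader at the (3.187) letters
`Uf ∕ Uc`), `inΛ i := inΛY (x i)` («y ∈ Λ»), `unitDist i := unitDistY (x i)` (`|y − y′|` on `T₁^{(k)}`).  Record defaults: `Sf i := (lettersYOfRecord … (x i)⁺).C`, `Sc i := (… (x i)).C`,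
`Uf ∕ Uc` the `.Ck` letters. [cite: King1986, p.664 (pairing convention), Prop. 3.9 (3.73) p.665 (objects only); Balaban1985BackgroundPropagators, Thm 3.1 (3.42) p.397, Thm 3.2 (3.48)
p.398, Thm 3.15 (3.187) p.432 (typing templates)] -/
def ne2ObjectsOfRecordYK : NE2Objects₁₁ :=
  ne2ObjectsOfRecordY G x n avg havg Of Oc (fun i => siteKernelS₂Y G (x i) (n i) (avg i) (Sf i) (Sc i))
    (fun i => siteKernelS₂Y G (x i) (n i) (avg i) (Uf i) (Uc i)) (fun i => inΛY (x i)) (fun i => unitDistY (x i)) c35 p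

/-- the instantiation, by `rfl`. [bookkeeping] -/
theorem ne2ObjectsOfRecordYK_eq :
    ne2ObjectsOfRecordYK G x n avg havg Of Oc Sf Sc Uf Uc c35 p =
      ne2ObjectsOfRecordY G x n avg havg Of Oc (fun i => siteKernelS₂Y G (x i) (n i) (avg i) (Sf i) (Sc i))
        (fun i => siteKernelS₂Y G (x i) (n i) (avg i) (Uf i) (Uc i)) (fun i => inΛY (x i)) (fun i => unitDistY (x i)) c35 p := rfl

/-- the SITE kernel at index `i` IS def-Y's two-member reader at the (3.48) letters (rfl). [bookkeeping] -/
theorem ksite_ne2ObjectsOfRecordYK (i : I) :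
    (ne2ObjectsOfRecordYK G x n avg havg Of Oc Sf Sc Uf Uc c35 p).Ksite i = siteKernelS₂Y G (x i) (n i) (avg i) (Sf i) (Sc i) := rfl

/-- the UNIT kernel at index `i` IS def-Y's two-member reader at the (3.187) letters (rfl). [bookkeeping] -/
theorem kunit_ne2ObjectsOfRecordYK (i : I) :
    (ne2ObjectsOfRecordYK G x n avg havg Of Oc Sf Sc Uf Uc c35 p).Kunit i = siteKernelS₂Y G (x i) (n i) (avg i) (Uf i) (Uc i) := rfl

/-- the region at index `i` IS «y ∈ Λ» of the member (rfl). [bookkeeping] -/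
theorem inΛ_ne2ObjectsOfRecordYK (i : I) : (ne2ObjectsOfRecordYK G x n avg havg Of Oc Sf Sc Uf Uc c35 p).inΛ i = inΛY (x i) := rfl

/-- the unit distance at index `i` IS `|y − y′|` on the member's unit lattice (rfl). [bookkeeping] -/
theorem unitDist_ne2ObjectsOfRecordYK (i : I) : (ne2ObjectsOfRecordYK G x n avg havg Of Oc Sf Sc Uf Uc c35 p).unitDist i = unitDistY (x i) := rfl

/-- the paired instance at index `i` IS def-Y's `pairedInstanceY` (rfl). [bookkeeping] -/
theorem pi_ne2ObjectsOfRecordYK (i : I) :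
    (ne2ObjectsOfRecordYK G x n avg havg Of Oc Sf Sc Uf Uc c35 p).pi i = pairedInstanceY 𝔸 G (x i) (n i) (avg i) (havg i) := rfl

/-- ★★ **`N15At` AT THE RECORD LITERAL WITH KERNELS BY NAME, UNFOLDED (`Iff.rfl`)**: the node's conjunction = N15's η-rate estimate `NE2PlusOperator` for def-Y's two-member (3.42)
reader ∧ the site clause `NE2PlusSite 4 p` for the two-member (3.48) reader at `Sf ∕ Sc` ∧ the unit clause `NE2PlusUnit` for the same reader at `Uf ∕ Uc` over «y ∈ Λ», `|y − y′|`.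
What a K3 pin of N15 AT THE RECORD displays; NOT printed and NOT proved here (the γ = 0 ∕ θ = 1 floors are def-Y's `etaRateIneqSite_zero_siteKernelS₂Y_of_bounds` ∕
`etaRateIneqUnit_one_siteKernelS₂Y_of_bounds`; the gain is N15's). [cite: Balaban1985BackgroundPropagators, Thm 3.1 (3.42) p.397, Thm 3.2 (3.48) p.398, Thm 3.15 (3.187) p.432,
Thm 3.14 pp.426–427; King1986, Prop. 3.9 (3.73) p.665] -/
theorem n15At_ne2ObjectsOfRecordYK_iff :
    N15At (ne2OfRecord₁₁ (ne2ObjectsOfRecordYK G x n avg havg Of Oc Sf Sc Uf Uc c35 p)) ↔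
      NE2PlusOperator c35 (fun i => pairedInstanceY 𝔸 G (x i) (n i) (avg i) (havg i)) (fun i => kernelFamilyS₂Y G (x i) (n i) (avg i) (Of i) (Oc i)) ∧
        NE2PlusSite 4 p c35 (fun i => pairedInstanceY 𝔸 G (x i) (n i) (avg i) (havg i)) (fun i => siteKernelS₂Y G (x i) (n i) (avg i) (Sf i) (Sc i)) ∧
        NE2PlusUnit c35 (fun i => pairedInstanceY 𝔸 G (x i) (n i) (avg i) (havg i)) (fun i => siteKernelS₂Y G (x i) (n i) (avg i) (Uf i) (Uc i))
          (fun i => inΛY (x i)) (fun i => unitDistY (x i)) :=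
  Iff.rfl

/-- ★ **THE SOCKET AT THE RECORD LITERAL WITH KERNELS BY NAME**: the three layer estimates ⟹ `N15At`. [cite: Balaban1985BackgroundPropagators, Thm 3.14 pp.426–427 (template)] -/
theorem n15At_ne2ObjectsOfRecordYK_of
    (hop : NE2PlusOperator c35 (fun i => pairedInstanceY 𝔸 G (x i) (n i) (avg i) (havg i)) (fun i => kernelFamilyS₂Y G (x i) (n i) (avg i) (Of i) (Oc i)))
    (hsite : NE2PlusSite 4 p c35 (fun i => pairedInstanceY 𝔸 G (x i) (n i) (avg i) (havg i)) (fun i => siteKernelS₂Y G (x i) (n i) (avg i) (Sf i) (Sc i)))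
    (hunit : NE2PlusUnit c35 (fun i => pairedInstanceY 𝔸 G (x i) (n i) (avg i) (havg i)) (fun i => siteKernelS₂Y G (x i) (n i) (avg i) (Uf i) (Uc i))
      (fun i => inΛY (x i)) (fun i => unitDistY (x i))) :
    N15At (ne2OfRecord₁₁ (ne2ObjectsOfRecordYK G x n avg havg Of Oc Sf Sc Uf Uc c35 p)) :=
  ⟨hop, hsite, hunit⟩

/-- conversely, the operator-layer estimate is READ OFF `N15At` at this literal. [bookkeeping] -/
theorem ne2PlusOperator_of_n15At_ne2ObjectsOfRecordYK
    (h : N15At (ne2OfRecord₁₁ (ne2ObjectsOfRecordYK G x n avg havg Of Oc Sf Sc Uf Uc c35 p))) :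
    NE2PlusOperator c35 (fun i => pairedInstanceY 𝔸 G (x i) (n i) (avg i) (havg i)) (fun i => kernelFamilyS₂Y G (x i) (n i) (avg i) (Of i) (Oc i)) :=
  h.1

end Kernels

end Summit.QuantumFields.YangMills.BalabanUVNodes.N15.GenuineRecord

end
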